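import Mathlib
import HarnessLib
import Literature.Analysis.FluidPDE.ClassicalSolution
import Literature.Analysis.FluidPDE.VectorCalculus
import Literature.Analysis.FluidPDE.NSBoundedMildOseen
import Literature.Analysis.UnboundedOperators.HeatKernel
import Summits.NavierStokesRegularity.NavierStokesRegularity.Theorems.UnthreadedRigidityDoorUnthreadedRigidityProfileHornDefs

/-!
# Route `UnthreadedRigidityDoor`, item `UnthreadedRigidity` (W2, stmt-NavierStokesRegularity-27585) — LINE g11-1 «VIRIAL HORN»
# (planner ns-idea-6 g11; idea-crit-4 g7 PASS — RUNG line — 2026-08-29T03:44Z): THE TYPED OBJECTS AND STATEMENTS of the line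
# (Theorems-side twin of the sketch)

Definition file (Theorems-side twin of the files-only line sketch `pub/ideators/ns-idea-6/lines/UnthreadedRigidityDoor/VirialHorn_sketch.lean`,
sha16 046ceb385f972470; namespace `…Theorems.UnthreadedRigidity.VirialHorn` instead of the sketch's `…Cruxes.UnthreadedRigidity.VirialHorn`; every
def BODY below is VERBATIM; `E3`, `threadingFlux`, `IsSliceAxisymmetric` are NOT re-declared — they are the byte-identical objects of the landed
PROFILE HORN twin (`…Theorems.UnthreadedRigidity.ProfileHorn`, p689891) opened into this namespace; the sketch's `import …Theses.UnthreadedRigidityDoor`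
is dropped — no body uses a Theses symbol).  Purpose: the supports S-V `VirialNondegeneracy`, S-A `AnalyticWedgeSeparableL`, S-Z `ZonalShellAxisym`
and the sketch's compositions can be stated BY NAME from `Theorems/`.  Filed by the W2 Lean hand ns-crc-p1 g7 (DIRECTOR-NS KEY-NS #188 (1)); author of
the statements: planner ns-idea-6 g11.

THE LINE (sketch docstring, abridged).  SEPARABLE / ISOTYPIC SECTOR IN EVERY ANGULAR DEGREE `l ≥ 1`: data `u₀ = curl curl (H(|y|) Y(y) · y)`, `Y ∈ V_l`
a solid harmonic, `H` a radial profile.  (F2) `c₂ = K · { Y , α²|∇Y|² − y·∇p }`, `{f,g} := y·(∇f×∇g)`, `α = rH′+(l+1)H`, `K = H″+2(l+1)H′/r`;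
(F3) the VIRIAL LEMMA kills all pressure multipoles after the homogeneity-matched radial integration and leaves
`(∫₀^∞ r^{2l−3} α² dr) · {Y,|∇Y|²} ≡ 0`; (F4) the ANGULAR LEMMA makes `Y` zonal.  Window level: (F1) ORDER-ONE LAW + wedge injectivity ⇒ piecewise
separable ⇒ (analyticity) separable.

Objects: `e`, `det3`, `pbr`, `dir2`, `lap3`, `IsSolidHarmonic`, `angForm`, `IsZonalAbout`, `IsZonal`, `strainAmpL`, `vortAmpL`, `VirialAdmissible`,
`sepShellL`, `virialMoment`, `isoShellL`, `IsoAdmissibleL`, `WedgeVanishesL`.  Statements: `AngularLemma` (S-C), `OrderTwoVirialIdentity` (BRIDGE V),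
`VirialNondegeneracy` (S-V), `ZonalShellAxisym` (S-Z), `SeparableOrderTwoRigidityL` (slice rung), `WindowWedgeAnalyticL` (BRIDGE W),
`AnalyticWedgeSeparableL` (S-A), `VirialWindowSilence` (BRIDGE V-W), `WindowAxisUniform` (S-U), `IsotypicWindowRigidityL` (window rung).

WHAT THIS IS NOT: no NS-regularity statement is touched; `UnthreadedRigidity` (27585), W2 and NS regularity stay OPEN; these are the objects of one
RUNG line on the wall item (the bridges among them carry the NS content and are labelled so in their docstrings); nobody here claims `UnthreadedRigidity`.
`--supports stmt-NavierStokesRegularity-27585 --as helper`.  [cite: MajdaBertozziCUP2002, §1.1 (vector identities)]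
-/

-- the summit and its single sub-problem share the name (CONVENTIONS §1)
set_option linter.dupNamespace false

namespace Summit.NavierStokesRegularity.NavierStokesRegularity.Theorems.UnthreadedRigidity.VirialHorn

open scoped Topology
open Filter Set
open Summit.NavierStokesRegularity.NavierStokesRegularity.Theorems.UnthreadedRigidity.ProfileHorn (E3 threadingFlux IsSliceAxisymmetric)
/-! ## Solid harmonics, the bracket `{f,g}`, the angular form `{Y,|∇Y|²}`, zonality -/

/-- standard basis vectors. -/
noncomputable def e (i : Fin 3) : E3 := EuclideanSpace.single i (1 : ℝ)

/-- `det[a,b,c] = a·(b×c)` written out. -/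
def det3 (a b c : E3) : ℝ :=
  a 0 * (b 1 * c 2 - b 2 * c 1) - a 1 * (b 0 * c 2 - b 2 * c 0) + a 2 * (b 0 * c 1 - b 1 * c 0)

/-- the bracket `{f,g}(y) = y·(∇f(y) × ∇g(y)) = det[y, ∇f, ∇g]` (the derivative of `g` along the rotation field `y × ∇f`). -/
noncomputable def pbr (f g : E3 → ℝ) (y : E3) : ℝ := det3 y (gradient f y) (gradient g y)

/-- second directional derivative along `v`. -/
noncomputable def dir2 (f : E3 → ℝ) (v : E3) (y : E3) : ℝ := fderiv ℝ (fun z => fderiv ℝ f z v) y v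

/-- the flat Laplacian. -/
noncomputable def lap3 (f : E3 → ℝ) (y : E3) : ℝ := ∑ i : Fin 3, dir2 f (e i) y

/-- `Y` is a SOLID HARMONIC of degree `l`: a real homogeneous polynomial of degree `l` in the coordinates with `ΔY = 0` (so `Y|_{S²} ∈ V_l`). -/
def IsSolidHarmonic (l : ℕ) (Y : E3 → ℝ) : Prop :=
  (∃ P : MvPolynomial (Fin 3) ℝ, P.IsHomogeneous l ∧ ∀ y : E3, Y y = MvPolynomial.eval (fun i => y i) P) ∧ ∀ y : E3, lap3 Y y = 0

/-- the ANGULAR FORM `𝒜(Y) = {Y, |∇Y|²}` — by (F2) the local (inertial) part of the second threading jet is `K α² 𝒜(Y)`; for `l = 2`,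
`𝒜(Y_Q) = 16 det[y,Qy,Q²y]` (g10's discriminant cubic). -/
noncomputable def angForm (Y : E3 → ℝ) (y : E3) : ℝ := pbr Y (fun z => ‖gradient Y z‖ ^ 2) y

/-- `Y` is invariant under rotations about the axis `a`: `(a × y)·∇Y(y) = det[a, y, ∇Y] = 0`. -/
def IsZonalAbout (a : E3) (Y : E3 → ℝ) : Prop := ∀ y : E3, det3 a y (gradient Y y) = 0

/-- ZONAL = axisymmetric about some axis. -/
def IsZonal (Y : E3 → ℝ) : Prop := ∃ a : E3, a ≠ 0 ∧ IsZonalAbout a Y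

/-- S-C «ANGULAR LEMMA» (support, S–M; CARD §4 — Cartan's isoparametric functions on the round sphere, 1938; Wang, Math. Ann. 277 (1987)):
a solid harmonic with `{Y,|∇Y|²} ≡ 0` is zonal.  (On `S²` the hypothesis says `|∇_S Y|²` is locally a function of `Y`; with `Δ_S Y = −l(l+1)Y` the
level curves have constant geodesic curvature — circles — and transnormality makes them coaxial; real-analyticity globalises.)  `l = 1`: every `Y`
is zonal; `l = 2`: `det[y,Qy,Q²y] ≡ 0 ⟺ Q` has a repeated eigenvalue. -/
def AngularLemma : Prop :=
  ∀ (l : ℕ) (Y : E3 → ℝ), IsSolidHarmonic l Y → (∀ y : E3, angForm Y y = 0) → IsZonal Y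

/-! ## Radial profiles, the separable shell of degree `l`, the virial moment -/

/-- `α_l[H] = rH′ + (l+1)H` (strain amplitude: `u₀ = α∇Y − βY y`, `β = lH′/r`). -/
noncomputable def strainAmpL (l : ℕ) (H : ℝ → ℝ) (r : ℝ) : ℝ := r * deriv H r + ((l : ℝ) + 1) * H r

/-- `K_l[H] = H″ + 2(l+1)H′/r` (vorticity amplitude: `ω₀ = −K ∇Y × y`). -/
noncomputable def vortAmpL (l : ℕ) (H : ℝ → ℝ) (r : ℝ) : ℝ := deriv (deriv H) r + 2 * ((l : ℝ) + 1) / r * deriv H r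

/-- VIRIAL-ADMISSIBLE profiles of degree `l`: smooth-even (`H(r) = h(r²)`) with power decay `r^{l+2}|H|, r^{l+3}|H′|, r^{l+4}|H″| ≤ C` on `[1,∞)`
(enough for `u₀ = O(|y|^{-3})`, finiteness of the virial moment and vanishing of the boundary terms `[r^L b_L]₀^∞`; the exterior potential tail
`H = c r^{−2l−1}` qualifies). -/
def VirialAdmissible (l : ℕ) (H : ℝ → ℝ) : Prop :=
  (∃ h : ℝ → ℝ, ContDiff ℝ (⊤ : ℕ∞) h ∧ ∀ r, 0 ≤ r → H r = h (r ^ 2)) ∧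
  ∃ C : ℝ, ∀ r, 1 ≤ r → r ^ (l + 2) * |H r| ≤ C ∧ r ^ (l + 3) * |deriv H r| ≤ C ∧ r ^ (l + 4) * |deriv (deriv H) r| ≤ C

/-- the SEPARABLE SHELL of degree `l`: `u₀ = curl curl (H(|y|) Y(y) y)`, `y = x − x₀` (for `l = 2`, `Y = Y_Q` this is g10's `sepShell`). -/
noncomputable def sepShellL (H : ℝ → ℝ) (Y : E3 → ℝ) (x₀ : E3) : E3 → E3 :=
  Literature.Analysis.FluidPDE.curl (Literature.Analysis.FluidPDE.curl
    (fun x : E3 => (H ‖x - x₀‖ * Y (x - x₀)) • (x - x₀)))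

/-- the VIRIAL MOMENT `∫₀^∞ r^{2l−3} α_l[H]² dr` (the weight is the homogeneity-matched one of (F3); natural-number exponent, `l ≥ 2` intended,
`l = 1` harmless). -/
noncomputable def virialMoment (l : ℕ) (H : ℝ → ℝ) : ℝ := ∫ r in Set.Ioi (0 : ℝ), r ^ (2 * l - 3) * strainAmpL l H r ^ 2


/-! ## Slice level: the virial bridge and the separable rung in every degree -/

/-- BRIDGE V «ORDER-TWO VIRIAL IDENTITY» (M–L).  M: for the classical solution on `[t₀,T)` from a virial-admissible separable shell the one-sided
second threading jet equals the formal jet `c₂` (interior/one-sided smoothness, as in g9/g10).  L = (F2)+(F3) of the CARD (hand proofs; (F2)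
checked symbolically, kit j323443): `c₂ = K{Y, α²|∇Y|² − y·∇p}` and the virial lemma turn `c₂ ≡ 0` into `(∫₀^∞ r^{2l−3}α²)·{Y,|∇Y|²} ≡ 0`.
(The jets of order 0 and 1 vanish identically for separable data — THEOREM SEP — so they are not hypotheses.)  WHY IT MIGHT FAIL: the M-part only
(formal jet = one-sided jet; decay of `p` fixes the harmonic gauge so that `b_L` are the Newtonian multipole coefficients). -/
def OrderTwoVirialIdentity : Prop :=
  ∀ (l : ℕ) (t₀ T : ℝ) (u : ℝ → E3 → E3) (p : ℝ → E3 → ℝ) (x₀ : E3) (Y : E3 → ℝ) (H : ℝ → ℝ),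
    1 ≤ l → t₀ < T →
    Literature.Analysis.FluidPDE.IsClassicalNSSolutionOn (Set.Ico t₀ T) 1 0 u p →
    (∀ t ∈ Set.Ico t₀ T, Tendsto (p t) (cocompact E3) (𝓝 0)) →
    IsSolidHarmonic l Y → VirialAdmissible l H → u t₀ = sepShellL H Y x₀ →
    (∀ x : E3, iteratedDerivWithin 2 (fun t => threadingFlux u x₀ t x) (Set.Ici t₀) t₀ = 0) →
    ∀ ξ : E3, virialMoment l H * angForm Y ξ = 0

/-- S-V «VIRIAL NONDEGENERACY» (support, S; real analysis, provable now): a virial-admissible profile with vanishing virial moment is null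
(`α ≡ 0 ⇒ (r^{l+1}H)′ = r^l α = 0 ⇒ r^{l+1}H` constant, `= 0` by regularity at `0`; then `H′ ≡ 0` too). -/
def VirialNondegeneracy : Prop :=
  ∀ (l : ℕ) (H : ℝ → ℝ), 1 ≤ l → VirialAdmissible l H → virialMoment l H = 0 →
    ∀ r : ℝ, 0 ≤ r → H r = 0

/-- S-Z «ZONAL SHELL IS AN AXISYMMETRIC SLICE» (support, S–M): `Y` zonal about `a` ⇒ `curl curl (H Y y)` commutes with rotations about `a`. -/
def ZonalShellAxisym : Prop :=
  ∀ (l : ℕ) (H : ℝ → ℝ) (Y : E3 → ℝ) (x₀ : E3), IsSolidHarmonic l Y → IsZonal Y → VirialAdmissible l H →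
    IsSliceAxisymmetric (sepShellL H Y x₀) x₀

/-- RUNG «SEPARABLE ORDER-TWO RIGIDITY IN EVERY DEGREE» (extends g10-2's `SeparableShellOrderTwoRigidity` from `l = 2` to all `l ≥ 1`):
a virial-admissible separable shell of degree `l`, left-end slice of a classical solution with decaying pressure, whose second one-sided
threading jet vanishes, is an axisymmetric slice.  Reduced below to V ∧ S-V ∧ S-C ∧ S-Z (kernel-checked); V's L-part, S-C are proved on paper. -/
def SeparableOrderTwoRigidityL : Prop :=
  ∀ (l : ℕ) (t₀ T : ℝ) (u : ℝ → E3 → E3) (p : ℝ → E3 → ℝ) (x₀ : E3) (Y : E3 → ℝ) (H : ℝ → ℝ),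
    1 ≤ l → t₀ < T →
    Literature.Analysis.FluidPDE.IsClassicalNSSolutionOn (Set.Ico t₀ T) 1 0 u p →
    (∀ t ∈ Set.Ico t₀ T, Tendsto (p t) (cocompact E3) (𝓝 0)) →
    IsSolidHarmonic l Y → VirialAdmissible l H → u t₀ = sepShellL H Y x₀ →
    (∀ x : E3, iteratedDerivWithin 2 (fun t => threadingFlux u x₀ t x) (Set.Ici t₀) t₀ = 0) →
    IsSliceAxisymmetric (u t₀) x₀


/-! ## Window level (the crux's own setting): isotypic windows of degree `l` -/

/-- the `l`-ISOTYPIC datum generated by radial coefficient profiles `c m` against solid harmonics `B m` (`m < n`; for a basis of `V_l`, `n = 2l+1`):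
`u₀ = curl curl ((Σ_m c_m(|y|) B_m(y)) y)` — every poloidal datum whose stream function lies in `V_l` on each sphere about `x₀`. -/
noncomputable def isoShellL (n : ℕ) (c : Fin n → ℝ → ℝ) (B : Fin n → E3 → ℝ) (x₀ : E3) : E3 → E3 :=
  Literature.Analysis.FluidPDE.curl (Literature.Analysis.FluidPDE.curl
    (fun x : E3 => (∑ m : Fin n, c m ‖x - x₀‖ * B m (x - x₀)) • (x - x₀)))

/-- ADMISSIBLE isotypic families of degree `l`. -/
def IsoAdmissibleL (l n : ℕ) (c : Fin n → ℝ → ℝ) (B : Fin n → E3 → ℝ) : Prop :=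
  (∀ m, IsSolidHarmonic l (B m)) ∧ ∀ m, VirialAdmissible l (c m)

/-- «PIECEWISE SEPARABLE»: all radial Wronskians `c_m c_{m′}′ − c_{m′} c_m′` vanish on `(0,∞)` (`Q ∧ Q′ = 0`). -/
def WedgeVanishesL (n : ℕ) (c : Fin n → ℝ → ℝ) : Prop :=
  ∀ m m' : Fin n, ∀ r : ℝ, 0 < r → c m r * deriv (c m') r - c m' r * deriv (c m) r = 0

/-- BRIDGE W «WINDOW WEDGE + ANALYTICITY, degree l» (M–L).  M: interior space-analyticity of bounded mild solutions ⇒ the coefficient profiles of a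
slice are analytic on `(0,∞)`; the flux is `≡ 0` in the window so the first jet vanishes at interior times.  L: (F1) ORDER-ONE LAW (CARD §6, hand
proof; kit j323443) `c₁ = −l(l+1) r^{−2l−2} ∂_r(r^{2l+2} ·) Σ_{m<m′} W_{mm′}(r) {B_m,B_{m′}}` plus INJECTIVITY of `Y∧Z ↦ {Y,Z}` on `Λ²V_l`
(certified by exact linear algebra for `l ≤ 7`, kit j323443; top channel for all `l` by highest weight) and the Euler step `r^{2l+2}W = const = 0`.
WHY IT MIGHT FAIL: injectivity for `l ≥ 8` is a conjecture (one finite computation per degree); the M-part. -/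
def WindowWedgeAnalyticL : Prop :=
  ∀ (l n : ℕ) (S : Set ℝ), 1 ≤ l → IsOpen S → ∀ (u : ℝ → E3 → E3) (x₀ : E3),
    ContinuousOn (Function.uncurry u) (S ×ˢ Set.univ) →
    (∀ t ∈ S, Literature.Analysis.FluidPDE.VectorCalculus.IsDivFree (u t)) →
    (∀ s ∈ S, ∀ t ∈ S, s < t → ∀ x, u t x =
        Literature.Analysis.UnboundedOperators.heatExtension (u s) (t - s) x
          - Literature.Analysis.FluidPDE.oseenDuhamel 1 s u u t x) →
    (∀ τ ∈ S, ∃ B : ℝ, ∀ t ∈ S, t ≤ τ → ∀ x, ‖u t x‖ ≤ B) →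
    (∀ t ∈ S, ∀ x, inner ℝ (Literature.Analysis.FluidPDE.curl (u t) x) (x - x₀) = 0) →
    ∀ (B : Fin n → E3 → ℝ) (cf : ℝ → Fin n → ℝ → ℝ), LinearIndependent ℝ B →
    (∀ t ∈ S, IsoAdmissibleL l n (cf t) B ∧ u t = isoShellL n (cf t) B x₀) →
    ∀ t ∈ S, WedgeVanishesL n (cf t) ∧ ∀ m, AnalyticOnNhd ℝ (cf t m) (Set.Ioi 0)

/-- S-A «ANALYTIC WEDGE ⇒ GLOBALLY SEPARABLE» (support, S; real analysis): analytic coefficient profiles with all Wronskians zero are proportional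
to one profile (`c_m = v_m H`), so the isotypic datum is a single separable shell with `Y = Σ v_m B_m ∈ V_l`. -/
def AnalyticWedgeSeparableL : Prop :=
  ∀ (l n : ℕ) (c : Fin n → ℝ → ℝ) (B : Fin n → E3 → ℝ) (x₀ : E3), IsoAdmissibleL l n c B →
    (∀ m, AnalyticOnNhd ℝ (c m) (Set.Ioi 0)) → WedgeVanishesL n c →
    ∃ (H : ℝ → ℝ) (Y : E3 → ℝ), VirialAdmissible l H ∧ IsSolidHarmonic l Y ∧ isoShellL n c B x₀ = sepShellL H Y x₀

/-- BRIDGE V-W «VIRIAL SILENCE IN A WINDOW» (M–L; V with the profile and the harmonic allowed to depend on `t`: interior time-smoothness ⇒ every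
jet of the identically vanishing flux vanishes at interior times; then (F2)+(F3)). -/
def VirialWindowSilence : Prop :=
  ∀ (l : ℕ) (S : Set ℝ), 1 ≤ l → IsOpen S → ∀ (u : ℝ → E3 → E3) (x₀ : E3),
    ContinuousOn (Function.uncurry u) (S ×ˢ Set.univ) →
    (∀ t ∈ S, Literature.Analysis.FluidPDE.VectorCalculus.IsDivFree (u t)) →
    (∀ s ∈ S, ∀ t ∈ S, s < t → ∀ x, u t x =
        Literature.Analysis.UnboundedOperators.heatExtension (u s) (t - s) x
          - Literature.Analysis.FluidPDE.oseenDuhamel 1 s u u t x) →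
    (∀ τ ∈ S, ∃ B : ℝ, ∀ t ∈ S, t ≤ τ → ∀ x, ‖u t x‖ ≤ B) →
    (∀ t ∈ S, ∀ x, inner ℝ (Literature.Analysis.FluidPDE.curl (u t) x) (x - x₀) = 0) →
    ∀ (Hf : ℝ → ℝ → ℝ) (Yf : ℝ → E3 → ℝ),
    (∀ t ∈ S, VirialAdmissible l (Hf t) ∧ IsSolidHarmonic l (Yf t) ∧ u t = sepShellL (Hf t) (Yf t) x₀) →
    ∀ t ∈ S, ∀ ξ : E3, virialMoment l (Hf t) * angForm (Yf t) ξ = 0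

/-- S-U «COMMON AXIS» (support, S–M; verbatim g10-1): slicewise axisymmetry about axes through `x₀` in a window ⇒ one common generator. -/
def WindowAxisUniform : Prop :=
  ∀ (S : Set ℝ), IsOpen S → IsPreconnected S → ∀ (u : ℝ → E3 → E3) (x₀ : E3),
    ContinuousOn (Function.uncurry u) (S ×ˢ Set.univ) →
    (∀ t ∈ S, Literature.Analysis.FluidPDE.VectorCalculus.IsDivFree (u t)) →
    (∀ s ∈ S, ∀ t ∈ S, s < t → ∀ x, u t x =
        Literature.Analysis.UnboundedOperators.heatExtension (u s) (t - s) x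
          - Literature.Analysis.FluidPDE.oseenDuhamel 1 s u u t x) →
    (∀ τ ∈ S, ∃ B : ℝ, ∀ t ∈ S, t ≤ τ → ∀ x, ‖u t x‖ ≤ B) →
    (∀ t ∈ S, IsSliceAxisymmetric (u t) x₀) →
    ∃ A : E3 →L[ℝ] E3, (∀ x, inner ℝ (A x) x = 0) ∧ A ≠ 0 ∧
      ∀ t ∈ S, ∀ x, fderiv ℝ (u t) x (A (x - x₀)) - A (u t x) = 0

/-- WINDOW RUNG «ISOTYPIC WINDOW RIGIDITY, degree l» = the crux 27585 with its hypotheses VERBATIM, restricted to windows all of whose slices are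
admissible `l`-isotypic poloidal data about `x₀` over a fixed linearly independent family of solid harmonics (time-dependent radial coefficients
allowed).  Bears on 27585 by name (restriction, `isotypicWindowRigidityL_of_crux`); COMPLETELY REDUCED to bridges + supports below. -/
def IsotypicWindowRigidityL (l n : ℕ) : Prop :=
  ∀ (S : Set ℝ), IsOpen S → IsPreconnected S → ∀ (u : ℝ → E3 → E3) (x₀ : E3),
    ContinuousOn (Function.uncurry u) (S ×ˢ Set.univ) →
    (∀ t ∈ S, Literature.Analysis.FluidPDE.VectorCalculus.IsDivFree (u t)) →
    (∀ s ∈ S, ∀ t ∈ S, s < t → ∀ x, u t x =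
        Literature.Analysis.UnboundedOperators.heatExtension (u s) (t - s) x
          - Literature.Analysis.FluidPDE.oseenDuhamel 1 s u u t x) →
    (∀ τ ∈ S, ∃ B : ℝ, ∀ t ∈ S, t ≤ τ → ∀ x, ‖u t x‖ ≤ B) →
    (∀ t ∈ S, ∀ x, inner ℝ (Literature.Analysis.FluidPDE.curl (u t) x) (x - x₀) = 0) →
    (∃ (B : Fin n → E3 → ℝ) (cf : ℝ → Fin n → ℝ → ℝ), LinearIndependent ℝ B ∧
        ∀ t ∈ S, IsoAdmissibleL l n (cf t) B ∧ u t = isoShellL n (cf t) B x₀) →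
    ∃ A : E3 →L[ℝ] E3, (∀ x, inner ℝ (A x) x = 0) ∧ A ≠ 0 ∧
      ∀ t ∈ S, ∀ x, fderiv ℝ (u t) x (A (x - x₀)) - A (u t x) = 0

end Summit.NavierStokesRegularity.NavierStokesRegularity.Theorems.UnthreadedRigidity.VirialHorn
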